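import Summits.QuantumFields.BalabanUV.Beta.FP.MixLoopPowerCountingMassQuartic
import Summits.QuantumFields.BalabanUV.Beta.FP.MixLoopPowerCountingCubicMoment

/-!
# `BalabanUV.Beta.FP.MixLoopPowerCountingMassCubic` — road «FP» (binder row D1), row **RHOA-6c′** «MASS-CURRENCY POWER COUNTING OF THE MIX LOOPS», the
# **(MIX-3)** twin `−2·tr(Q̇·Γ₀·Ḣ·𝓘)`: FILE D's bound with the uniform 3-jet mass `A∕n³` replaced by the INLINE per-insertion mass `M(b) = Σ_{u∈U b}Σ_{w∈W}|q̇(u;b,b+w)|`, and the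
# second moment taken for the COARSE J-contracted kernel in the road-FP OWNER's mass currency (R-FP-26) ([folklore]; abstract kernels, every letter displayed; NO road object)

HONEST DEPENDENCY (page 1, mandatory): continuum YM on T⁴ ⇐ BetaPertH ∧ nine spine estimates (0/9 proved); BetaPertH ⇐ (D1) ∧ (D4) ∧
CAP+tail; G-an2-4 gates asym, D1 and NE2/3/4.  HONEST FRAMING (cell contract, verbatim): «discharging `BetaPertH` makes Bałaban's UV
stability UNCONDITIONAL — a real constructive-QFT result; it is NOT the continuum limit and NOT the Clay problem.»  THIS MODULE is elementary
[folklore] real analysis on `ℤ⁴` over `MixLoopPowerCountingMassQuartic.coarse_secondMoment_of_majorant` (the J-contraction lemma), FILE D's cubic-loop leg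
`MixLoopPowerCountingCubicMoment.abs_cubicT_le` and engine instances `sum_inv_cube_mul_exp_le`∕`sum_sq_div_cube_mul_exp_le`, and `LatticeConvolutionBounds.sum_inv_pow_le`;
it asserts nothing about Bałaban's objects, cites nothing, mints no `Prop` fact, has no `def`, 0 sorry.  NOT `Mix_n = O(1)` for Bałaban's objects (row RHOA-6e assembles),
NOT `hbook`, NOT D1, NOT BetaPertH, NOT continuum, NOT Clay.

THE LETTERS (`n ≥ 1`, field-leg radius multiplier `R`): the cubic leg's letters EXACTLY as in FILE D (`|𝓘| ≤ C_I` sup only; `|Γ₀| ≤ C_Γ`, first differences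
`C′_Γ(‖c−t‖+1)⁻³e^{−(δ∕n)‖c−t‖}`; `|Ḣ(b′;x,x′)| ≤ C_He^{−δ_H(|x−b′|₁+|x′−b′|₁)}`, ZERO MASS `Σ'_xḢ(b′;x,x′) = 0`); (W) `‖w‖∞ ≤ R·n`; the owner's (J), (J′) and the
windowed insertion mass (M) `Σ_{b∈S}e^{−(δ∕(2n))‖b−n•v₀‖}·M(b) ≤ A_M` with `M(b)` INLINE.
WHERE THE n SITS (displayed, not hidden): the cubic leg's profile `Φ(r) = K₁e^{−(3δ∕4n)r}∕(r+1)³ + K₂∕(r+1)⁸` has ZEROTH fine moment `≍ K₁·n` (`Σ_r 80r³·r⁻³e^{−r∕n}`), so the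
windowed majorant and the final bound carry the explicit factor `Ψ = K₁·((1+2R²)(1+80e^{3δ∕8}(8∕(3δ))) + 2(1+160e^{3δ∕8}(8∕(3δ))³))·n + K₂·81·(3+2R²)`; in the road's units
`C_J·C_J′·A_M ≍ n⁻¹` (R-FP-26 (e), `ROOTING-MIX.md` §2 (ii)), which is what makes `3C_JC_J′(1+16∕δ²)·L·Ψ·A_M` an O(1) — RHOA-6e's bookkeeping, as for the owner's (MIX-2) file whose
`C_JC_J′A_M²` is O(1) the same way.  FILE D's fine second moment `(A∕n³)·𝔎·n³` is the uniform special case.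
CONTENT: `sum_weight_mixedProfile_le` (`Σ_{b′∈S}(1 + ‖b′−b‖²∕n²)·Φ(‖c−b′‖) ≤ Ψ` for `‖c−b‖ ≤ R·n`), `abs_mix3_le_mass` (`|k₃(b,b′)| ≤ L·Σ_{u,w}|q̇(u;b,b+w)|·Φ(‖b+w−b′‖)`,
`L = C_I·(C_H·Zl 4 δ_H)`), `windowedMajorant_mix3_le` ((Mκ₃) `≤ L·Ψ·A_M`), **`coarse_mix3_secondMoment_le`** (`Σ_{v∈V}‖v−v₀‖∞²·|Σ_{b,b′∈S}J b v₀·J b′ v·k₃(b,b′)| ≤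
3C_JC_J′(1+16∕δ²)·(L·Ψ·A_M)`).
Provenance: cross-cell idle-seat kernel duty NE7b → β∕D1, unit `b2b-balaban-t4-ne7b-formalise-leaf-01` gen 23 (first-refusal holder of RHOA-6c′), 2026-08-21; «not in print; our
bookkeeping»; no existing file touched.
-/

noncomputable section

namespace Summit.QuantumFields.BalabanUV.Beta.FP.MixLoopPowerCountingMassCubic

open Finset Real
open scoped BigOperators
open Literature.MathematicalPhysics.QuantumFieldTheory.Balaban1983to89
open Literature.MathematicalPhysics.QuantumFieldTheory.Balaban1983to89.Beta
open B12Sec2to5 (l1)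
open ExpKernelCalculus (Zl Zl_pos)
open DyadicShell (Pt supNorm)
open BlockLegs (supNorm_sub_le_real supNorm_add_le_real)
open Summit.QuantumFields.BalabanUV.Beta.FP.LatticeConvolutionBounds (sum_inv_pow_le)
open Summit.QuantumFields.BalabanUV.Beta.FP.MixLoopPowerCounting (supNorm_cast_nonneg)
open Summit.QuantumFields.BalabanUV.Beta.FP.MixLoopPowerCountingCubicMoment (sum_inv_cube_mul_exp_le sum_sq_div_cube_mul_exp_le abs_cubicT_le)
open Summit.QuantumFields.BalabanUV.Beta.FP.MixLoopPowerCountingMassQuartic (coarse_secondMoment_of_majorant)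

/-! ## §1 The cubic profile against the pair weight `(1 + ‖b′−b‖²∕n²)`: zeroth + second fine moments, explicit `n` -/

/-- [folklore] **THE CUBIC PROFILE's WEIGHTED ZEROTH MOMENT**: for `‖c − b‖∞ ≤ R·n`, nonnegative `K₁, K₂`, rate `δ′ > 0`,
`Σ_{b′∈S}(1 + (‖b′−b‖∕n)²)·(K₁e^{−(δ′∕n)‖c−b′‖}∕(‖c−b′‖+1)³ + K₂∕(‖c−b′‖+1)⁸) ≤ K₁((1+2R²)(1+80e^{δ′∕2}(2∕δ′)) + 2(1+160e^{δ′∕2}(2∕δ′)³))·n + K₂·81·(3+2R²)`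
(`‖b′−b‖ ≤ ‖c−b′‖ + Rn`; FILE D's engine instances `j = 0, 2`; `Σ(‖y‖+1)^{−8}, Σ‖y‖²(‖y‖+1)^{−8} ≤ 81`; `n⁻² ≤ 1`). -/
theorem sum_weight_mixedProfile_le {δ' K₁ K₂ : ℝ} (hδ' : 0 < δ') (hK₁ : 0 ≤ K₁) (hK₂ : 0 ≤ K₂) {n R : ℕ} (hn : 1 ≤ n) {b c : Pt}
    (hc : supNorm (c - b) ≤ R * n) (S : Finset Pt) :
    ∑ b' ∈ S, (1 + ((supNorm (b' - b) : ℝ) / n) ^ 2) *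
        (K₁ * (Real.exp (-(δ' / n) * (supNorm (c - b') : ℝ)) / ((supNorm (c - b') : ℝ) + 1) ^ 3) + K₂ / ((supNorm (c - b') : ℝ) + 1) ^ 8)
      ≤ K₁ * ((1 + 2 * (R : ℝ) ^ 2) * (1 + 80 * Real.exp (δ' / 2) * (2 / δ')) + 2 * (1 + 160 * Real.exp (δ' / 2) * (2 / δ') ^ 3)) * n
        + K₂ * 81 * (3 + 2 * (R : ℝ) ^ 2) := by
  have hn' : (1 : ℝ) ≤ n := by exact_mod_cast hn
  have hn0 : (0 : ℝ) < n := by linarith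
  set g : Pt → ℝ := fun y =>
      K₁ * ((1 + 2 * (R : ℝ) ^ 2) * (Real.exp (-(δ' / n) * (supNorm y : ℝ)) / ((supNorm y : ℝ) + 1) ^ 3)
        + 2 * ((n : ℝ) ^ 2)⁻¹ * ((supNorm y : ℝ) ^ 2 * Real.exp (-(δ' / n) * (supNorm y : ℝ)) / ((supNorm y : ℝ) + 1) ^ 3))
      + K₂ * ((1 + 2 * (R : ℝ) ^ 2) * (1 / ((supNorm y : ℝ) + 1) ^ 8) + 2 * (1 / ((supNorm y : ℝ) + 1) ^ 6)) with hg
  have hterm : ∀ b' ∈ S, (1 + ((supNorm (b' - b) : ℝ) / n) ^ 2) *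
      (K₁ * (Real.exp (-(δ' / n) * (supNorm (c - b') : ℝ)) / ((supNorm (c - b') : ℝ) + 1) ^ 3) + K₂ / ((supNorm (c - b') : ℝ) + 1) ^ 8)
        ≤ g (c - b') := by
    intro b' _
    set y : Pt := c - b' with hy
    have hys := supNorm_cast_nonneg y
    have h1 : (0 : ℝ) < (supNorm y : ℝ) + 1 := by linarith
    -- `(‖b′−b‖/n)² ≤ 2(‖y‖/n)² + 2R²`
    have htri : (supNorm (b' - b) : ℝ) ≤ (supNorm y : ℝ) + R * n := by
      have e : b' - b = (c - b) - y := by rw [hy]; abel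
      have h2 := supNorm_sub_le_real (c - b) y
      have h4 : (supNorm (c - b) : ℝ) ≤ R * n := by exact_mod_cast hc
      rw [e]; linarith
    have hw : ((supNorm (b' - b) : ℝ) / n) ^ 2 ≤ 2 * ((supNorm y : ℝ) / n) ^ 2 + 2 * (R : ℝ) ^ 2 := by
      have h0 : (0 : ℝ) ≤ (supNorm (b' - b) : ℝ) / n := by positivity
      have hd : (supNorm (b' - b) : ℝ) / n ≤ (supNorm y : ℝ) / n + R := by
        rw [div_add' _ _ _ hn0.ne', div_le_div_iff_of_pos_right hn0]; linarith
      nlinarith [pow_le_pow_left₀ h0 hd 2, sq_nonneg ((supNorm y : ℝ) / n - R)]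
    have hyn : ((supNorm y : ℝ) / n) ^ 2 = ((n : ℝ) ^ 2)⁻¹ * (supNorm y : ℝ) ^ 2 := by field_simp
    -- `‖y‖²/(‖y‖+1)⁸ ≤ 1/(‖y‖+1)⁶`, and `n⁻² ≤ 1`
    have h68 : (supNorm y : ℝ) ^ 2 * (1 / ((supNorm y : ℝ) + 1) ^ 8) ≤ 1 / ((supNorm y : ℝ) + 1) ^ 6 := by
      rw [mul_one_div, div_le_div_iff₀ (pow_pos h1 8) (pow_pos h1 6)]
      have : (supNorm y : ℝ) ^ 2 ≤ ((supNorm y : ℝ) + 1) ^ 2 := by gcongr; linarith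
      nlinarith [pow_pos h1 6, this]
    have hn2 : ((n : ℝ) ^ 2)⁻¹ ≤ 1 := inv_le_one_of_one_le₀ (one_le_pow₀ hn')
    set E : ℝ := Real.exp (-(δ' / n) * (supNorm y : ℝ)) with hE
    have hE0 : 0 < E := Real.exp_pos _
    have eK2 : K₂ / ((supNorm y : ℝ) + 1) ^ 8 = K₂ * (1 / ((supNorm y : ℝ) + 1) ^ 8) := by rw [mul_one_div]
    rw [eK2]
    have hP1 : 0 ≤ E / ((supNorm y : ℝ) + 1) ^ 3 := by positivity
    have hP2 : 0 ≤ 1 / ((supNorm y : ℝ) + 1) ^ 8 := by positivity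
    calc (1 + ((supNorm (b' - b) : ℝ) / n) ^ 2) * (K₁ * (E / ((supNorm y : ℝ) + 1) ^ 3) + K₂ * (1 / ((supNorm y : ℝ) + 1) ^ 8))
        ≤ (1 + 2 * (R : ℝ) ^ 2 + 2 * (((n : ℝ) ^ 2)⁻¹ * (supNorm y : ℝ) ^ 2)) *
            (K₁ * (E / ((supNorm y : ℝ) + 1) ^ 3) + K₂ * (1 / ((supNorm y : ℝ) + 1) ^ 8)) := by
          refine mul_le_mul_of_nonneg_right ?_ (by positivity)
          rw [← hyn]; linarith
      _ = K₁ * ((1 + 2 * (R : ℝ) ^ 2) * (E / ((supNorm y : ℝ) + 1) ^ 3)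
            + 2 * ((n : ℝ) ^ 2)⁻¹ * ((supNorm y : ℝ) ^ 2 * E / ((supNorm y : ℝ) + 1) ^ 3))
          + K₂ * ((1 + 2 * (R : ℝ) ^ 2) * (1 / ((supNorm y : ℝ) + 1) ^ 8)
            + 2 * ((n : ℝ) ^ 2)⁻¹ * ((supNorm y : ℝ) ^ 2 * (1 / ((supNorm y : ℝ) + 1) ^ 8))) := by ring
      _ ≤ K₁ * ((1 + 2 * (R : ℝ) ^ 2) * (E / ((supNorm y : ℝ) + 1) ^ 3)
            + 2 * ((n : ℝ) ^ 2)⁻¹ * ((supNorm y : ℝ) ^ 2 * E / ((supNorm y : ℝ) + 1) ^ 3))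
          + K₂ * ((1 + 2 * (R : ℝ) ^ 2) * (1 / ((supNorm y : ℝ) + 1) ^ 8) + 2 * 1 * (1 / ((supNorm y : ℝ) + 1) ^ 6)) := by
          gcongr
      _ = g y := by rw [hg]; ring
  -- reindex `b′ ↦ y = c − b′` and sum
  have hinj : Set.InjOn (fun b' : Pt => c - b') S := fun x _ x' _ h => sub_right_injective h
  set S' := S.image (fun b' => c - b') with hS'
  have hsum : ∑ b' ∈ S, g (c - b') = ∑ y ∈ S', g y := (Finset.sum_image hinj).symm
  have hA := sum_inv_cube_mul_exp_le hδ' hn S'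
  have hB := sum_sq_div_cube_mul_exp_le hδ' hn S'
  have hC : ∑ y ∈ S', 1 / ((supNorm y : ℝ) + 1) ^ 8 ≤ 81 := sum_inv_pow_le (by norm_num) S'
  have hD : ∑ y ∈ S', 1 / ((supNorm y : ℝ) + 1) ^ 6 ≤ 81 := sum_inv_pow_le (by norm_num) S'
  have hn2 : ((n : ℝ) ^ 2)⁻¹ * (n : ℝ) ^ 3 = n := by field_simp
  calc _ ≤ ∑ b' ∈ S, g (c - b') := Finset.sum_le_sum hterm
    _ = ∑ y ∈ S', g y := hsum
    _ = K₁ * ((1 + 2 * (R : ℝ) ^ 2) * ∑ y ∈ S', Real.exp (-(δ' / n) * (supNorm y : ℝ)) / ((supNorm y : ℝ) + 1) ^ 3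
            + 2 * ((n : ℝ) ^ 2)⁻¹ * ∑ y ∈ S', (supNorm y : ℝ) ^ 2 * Real.exp (-(δ' / n) * (supNorm y : ℝ)) / ((supNorm y : ℝ) + 1) ^ 3)
        + K₂ * ((1 + 2 * (R : ℝ) ^ 2) * ∑ y ∈ S', 1 / ((supNorm y : ℝ) + 1) ^ 8 + 2 * ∑ y ∈ S', 1 / ((supNorm y : ℝ) + 1) ^ 6) := by
        rw [hg]
        simp only [Finset.sum_add_distrib, ← Finset.mul_sum]
    _ ≤ K₁ * ((1 + 2 * (R : ℝ) ^ 2) * ((1 + 80 * Real.exp (δ' / 2) * (2 / δ')) * n)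
            + 2 * ((n : ℝ) ^ 2)⁻¹ * ((1 + 160 * Real.exp (δ' / 2) * (2 / δ') ^ 3) * (n : ℝ) ^ 3))
        + K₂ * ((1 + 2 * (R : ℝ) ^ 2) * 81 + 2 * 81) := by gcongr
    _ = _ := by
        have e : 2 * ((n : ℝ) ^ 2)⁻¹ * ((1 + 160 * Real.exp (δ' / 2) * (2 / δ') ^ 3) * (n : ℝ) ^ 3)
            = 2 * (1 + 160 * Real.exp (δ' / 2) * (2 / δ') ^ 3) * (((n : ℝ) ^ 2)⁻¹ * (n : ℝ) ^ 3) := by ring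
        rw [e, hn2]; ring

/-! ## §2 (MIX-3) in the mass currency -/

section Mix3

variable {U : Pt → Finset Pt} {W : Finset Pt} {qd : Pt → Pt → Pt → ℝ} {I Γ J : Pt → Pt → ℝ} {H : Pt → Pt → Pt → ℝ}
  {C_I C_Γ C_Γ' C_H C_J C_J' A_M δ δH : ℝ} {n R : ℕ}

/-- **(MIX-3) POINTWISE WITH THE INSERTION MASS INLINE**: `|k₃(b,b′)| ≤ Σ_{u∈U b}Σ_{w∈W}|q̇(u;b,b+w)|·(C_I·(C_H·Zl 4 δ_H))·Φ(‖b+w−b′‖)` with FILE D's profile `Φ`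
(`abs_cubicT_le` termwise). [folklore] -/
theorem abs_mix3_le_mass (hδ : 0 < δ) (hδH : 0 < δH) (hn : 1 ≤ n) (hI0 : ∀ x' u, |I x' u| ≤ C_I) (hΓ0 : ∀ c x, |Γ c x| ≤ C_Γ)
    (hΓ1 : ∀ c t (i : Fin 4), |Γ c (t + Pi.single i 1) - Γ c t|
      ≤ C_Γ' / ((supNorm (c - t) : ℝ) + 1) ^ 3 * Real.exp (-(δ / n) * (supNorm (c - t) : ℝ)))
    (hH : ∀ b' x x', |H b' x x'| ≤ C_H * Real.exp (-δH * l1 (x - b')) * Real.exp (-δH * l1 (x' - b')))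
    (hH0 : ∀ b' x', ∑' x, H b' x x' = 0) (b b' : Pt) :
    |∑ u ∈ U b, ∑ w ∈ W, qd u b (b + w) * ∑' x', I x' u * ∑' x, Γ (b + w) x * H b' x x'|
      ≤ ∑ u ∈ U b, ∑ w ∈ W, |qd u b (b + w)| * (C_I * (C_H * Zl 4 δH) *
        ((256 / 27 * C_Γ' * (Real.exp (δH / 2) * (2 / δH) * Zl 4 (δH / 2)))
            * (Real.exp (-(3 * δ / 4 / n) * (supNorm (b + w - b') : ℝ)) / ((supNorm (b + w - b') : ℝ) + 1) ^ 3)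
          + (2 * C_Γ * 20 ^ 8 * (40320 * Real.exp (δH / 2) * (2 / δH) ^ 8 * Zl 4 (δH / 2))
              + (8 * C_Γ * (Real.exp (δH / 2) * (2 / δH) * Zl 4 (δH / 2)) + 2 * C_Γ * (Real.exp (δH / 2) * Zl 4 (δH / 2))) * 5 ^ 8)
            / ((supNorm (b + w - b') : ℝ) + 1) ^ 8)) := by
  refine (Finset.abs_sum_le_sum_abs _ _).trans (Finset.sum_le_sum fun u _ =>
    (Finset.abs_sum_le_sum_abs _ _).trans (Finset.sum_le_sum fun w _ => ?_))
  rw [abs_mul]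
  exact mul_le_mul_of_nonneg_left (abs_cubicT_le (I := I) hδ hδH hn hI0 hΓ0 hΓ1 hH hH0 (b + w) b' u).2 (abs_nonneg _)

/-- **THE WINDOWED MAJORANT OF (MIX-3)** from (M) and the cubic profile's weighted zeroth moment (`sum_weight_mixedProfile_le`, explicit `n`): with
`κ₃(b,b′) := Σ_{u,w}|q̇(u;b,b+w)|·L·Φ(‖b+w−b′‖)`, `Σ_{b,b′∈S} e^{−(δ∕(2n))‖b−n•v₀‖}(1 + ‖b′−b‖²∕n²)κ₃(b,b′) ≤ L·Ψ·A_M`. [folklore] -/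
theorem windowedMajorant_mix3_le {K₁ K₂ L : ℝ} (hδ : 0 < δ) (hn : 1 ≤ n) (hK₁ : 0 ≤ K₁) (hK₂ : 0 ≤ K₂) (hL : 0 ≤ L)
    (hW : ∀ w ∈ W, supNorm w ≤ R * n) (S : Finset Pt) (v₀ : Pt)
    (hM : ∑ b ∈ S, Real.exp (-(δ / (2 * n)) * (supNorm (b - (n : ℤ) • v₀) : ℝ)) * (∑ u ∈ U b, ∑ w ∈ W, |qd u b (b + w)|) ≤ A_M) :
    ∑ b ∈ S, ∑ b' ∈ S, Real.exp (-(δ / (2 * n)) * (supNorm (b - (n : ℤ) • v₀) : ℝ)) * (1 + ((supNorm (b' - b) : ℝ) / n) ^ 2) *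
        (∑ u ∈ U b, ∑ w ∈ W, |qd u b (b + w)| * (L *
          (K₁ * (Real.exp (-(3 * δ / 4 / n) * (supNorm (b + w - b') : ℝ)) / ((supNorm (b + w - b') : ℝ) + 1) ^ 3)
            + K₂ / ((supNorm (b + w - b') : ℝ) + 1) ^ 8)))
      ≤ L * (K₁ * ((1 + 2 * (R : ℝ) ^ 2) * (1 + 80 * Real.exp ((3 * δ / 4) / 2) * (2 / (3 * δ / 4)))
              + 2 * (1 + 160 * Real.exp ((3 * δ / 4) / 2) * (2 / (3 * δ / 4)) ^ 3)) * n
            + K₂ * 81 * (3 + 2 * (R : ℝ) ^ 2)) * A_M := by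
  have hδ' : 0 < 3 * δ / 4 := by positivity
  set Ψ : ℝ := K₁ * ((1 + 2 * (R : ℝ) ^ 2) * (1 + 80 * Real.exp ((3 * δ / 4) / 2) * (2 / (3 * δ / 4)))
      + 2 * (1 + 160 * Real.exp ((3 * δ / 4) / 2) * (2 / (3 * δ / 4)) ^ 3)) * n + K₂ * 81 * (3 + 2 * (R : ℝ) ^ 2) with hΨ
  have hΨ0 : 0 ≤ Ψ := by positivity
  set E : Pt → ℝ := fun b => Real.exp (-(δ / (2 * n)) * (supNorm (b - (n : ℤ) • v₀) : ℝ)) with hE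
  set Φ : Pt → Pt → ℝ := fun c b' =>
      K₁ * (Real.exp (-(3 * δ / 4 / n) * (supNorm (c - b') : ℝ)) / ((supNorm (c - b') : ℝ) + 1) ^ 3) + K₂ / ((supNorm (c - b') : ℝ) + 1) ^ 8
    with hΦ
  -- for fixed `b`: swap `Σ_{b′}` inside `Σ_{u,w}` and use the profile's weighted zeroth moment
  have hinner : ∀ b ∈ S, ∑ b' ∈ S, (1 + ((supNorm (b' - b) : ℝ) / n) ^ 2) *
      (∑ u ∈ U b, ∑ w ∈ W, |qd u b (b + w)| * (L * Φ (b + w) b'))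
        ≤ (∑ u ∈ U b, ∑ w ∈ W, |qd u b (b + w)|) * (L * Ψ) := by
    intro b _
    have hprof : ∀ w ∈ W, ∑ b' ∈ S, (1 + ((supNorm (b' - b) : ℝ) / n) ^ 2) * Φ (b + w) b' ≤ Ψ := by
      intro w hw
      have hc : supNorm (b + w - b) ≤ R * n := by rw [add_sub_cancel_left]; exact hW w hw
      have h := sum_weight_mixedProfile_le (δ' := 3 * δ / 4) hδ' hK₁ hK₂ hn (c := b + w) hc S
      rw [hΨ]
      refine le_trans (le_of_eq (Finset.sum_congr rfl fun b' _ => by rw [hΦ])) h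
    calc ∑ b' ∈ S, (1 + ((supNorm (b' - b) : ℝ) / n) ^ 2) * (∑ u ∈ U b, ∑ w ∈ W, |qd u b (b + w)| * (L * Φ (b + w) b'))
        = ∑ b' ∈ S, ∑ u ∈ U b, ∑ w ∈ W, (1 + ((supNorm (b' - b) : ℝ) / n) ^ 2) * (|qd u b (b + w)| * (L * Φ (b + w) b')) := by
          refine Finset.sum_congr rfl fun b' _ => ?_
          rw [Finset.mul_sum]
          exact Finset.sum_congr rfl fun u _ => by rw [Finset.mul_sum]
      _ = ∑ u ∈ U b, ∑ b' ∈ S, ∑ w ∈ W, (1 + ((supNorm (b' - b) : ℝ) / n) ^ 2) * (|qd u b (b + w)| * (L * Φ (b + w) b')) :=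
          Finset.sum_comm
      _ = ∑ u ∈ U b, ∑ w ∈ W, ∑ b' ∈ S, (1 + ((supNorm (b' - b) : ℝ) / n) ^ 2) * (|qd u b (b + w)| * (L * Φ (b + w) b')) :=
          Finset.sum_congr rfl fun u _ => Finset.sum_comm
      _ = ∑ u ∈ U b, ∑ w ∈ W, |qd u b (b + w)| * (L * ∑ b' ∈ S, (1 + ((supNorm (b' - b) : ℝ) / n) ^ 2) * Φ (b + w) b') := by
          refine Finset.sum_congr rfl fun u _ => Finset.sum_congr rfl fun w _ => ?_
          rw [Finset.mul_sum, Finset.mul_sum]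
          exact Finset.sum_congr rfl fun b' _ => by ring
      _ ≤ ∑ u ∈ U b, ∑ w ∈ W, |qd u b (b + w)| * (L * Ψ) :=
          Finset.sum_le_sum fun u _ => Finset.sum_le_sum fun w hw =>
            mul_le_mul_of_nonneg_left (mul_le_mul_of_nonneg_left (hprof w hw) hL) (abs_nonneg _)
      _ = (∑ u ∈ U b, ∑ w ∈ W, |qd u b (b + w)|) * (L * Ψ) := by
          rw [Finset.sum_mul]; exact Finset.sum_congr rfl fun u _ => by rw [Finset.sum_mul]
  calc _ = ∑ b ∈ S, E b * ∑ b' ∈ S, (1 + ((supNorm (b' - b) : ℝ) / n) ^ 2) *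
          (∑ u ∈ U b, ∑ w ∈ W, |qd u b (b + w)| * (L * Φ (b + w) b')) := by
        refine Finset.sum_congr rfl fun b _ => ?_
        rw [Finset.mul_sum]
        exact Finset.sum_congr rfl fun b' _ => by simp only [hΦ, hE]; ring
    _ ≤ ∑ b ∈ S, E b * ((∑ u ∈ U b, ∑ w ∈ W, |qd u b (b + w)|) * (L * Ψ)) :=
        Finset.sum_le_sum fun b hb => mul_le_mul_of_nonneg_left (hinner b hb) (Real.exp_pos _).le
    _ = L * Ψ * ∑ b ∈ S, E b * ∑ u ∈ U b, ∑ w ∈ W, |qd u b (b + w)| := by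
        rw [Finset.mul_sum]; exact Finset.sum_congr rfl fun b _ => by ring
    _ ≤ L * Ψ * A_M := mul_le_mul_of_nonneg_left (by simpa only [hE] using hM) (by positivity)
    _ = L * Ψ * A_M := rfl

/-- **(MIX-3) MASS-CURRENCY COARSE SECOND MOMENT**: under FILE D's cubic-leg letters, (W), the owner's (J), (J′), (M), for finite fine window `S` and coarse window `V`,
`Σ_{v∈V}‖v−v₀‖∞²·|Σ_{b,b′∈S}J b v₀·J b′ v·k₃(b,b′)| ≤ 3·C_J·C_J′·(1 + 16∕δ²)·(L·Ψ·A_M)`, `L = C_I·(C_H·Zl 4 δ_H)`, `Ψ = K₁·Θ₁(δ,R)·n + K₂·81·(3+2R²)` DISPLAYED with its `n`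
(the cubic leg's zeroth fine moment; `C_JC_J′A_M ≍ n⁻¹` in the road's units — RHOA-6e's bookkeeping). The J-contraction lemma at the majorant of `abs_mix3_le_mass`. [folklore] -/
theorem coarse_mix3_secondMoment_le (hδ : 0 < δ) (hδH : 0 < δH) (hn : 1 ≤ n) (hW : ∀ w ∈ W, supNorm w ≤ R * n)
    (hI0 : ∀ x' u, |I x' u| ≤ C_I) (hΓ0 : ∀ c x, |Γ c x| ≤ C_Γ)
    (hΓ1 : ∀ c t (i : Fin 4), |Γ c (t + Pi.single i 1) - Γ c t|
      ≤ C_Γ' / ((supNorm (c - t) : ℝ) + 1) ^ 3 * Real.exp (-(δ / n) * (supNorm (c - t) : ℝ)))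
    (hH : ∀ b' x x', |H b' x x'| ≤ C_H * Real.exp (-δH * l1 (x - b')) * Real.exp (-δH * l1 (x' - b')))
    (hH0 : ∀ b' x', ∑' x, H b' x x' = 0) (S V : Finset Pt) (v₀ : Pt)
    (hJ : ∀ b, |J b v₀| ≤ C_J * Real.exp (-(δ / n) * (supNorm (b - (n : ℤ) • v₀) : ℝ)))
    (hJ' : ∀ b', ∑ v ∈ V, (1 + ((supNorm (b' - (n : ℤ) • v) : ℝ) / n) ^ 2) * |J b' v| ≤ C_J')
    (hM : ∑ b ∈ S, Real.exp (-(δ / (2 * n)) * (supNorm (b - (n : ℤ) • v₀) : ℝ)) * (∑ u ∈ U b, ∑ w ∈ W, |qd u b (b + w)|) ≤ A_M) :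
    ∑ v ∈ V, (supNorm (v - v₀) : ℝ) ^ 2 *
        |∑ b ∈ S, ∑ b' ∈ S, J b v₀ * J b' v *
          (∑ u ∈ U b, ∑ w ∈ W, qd u b (b + w) * ∑' x', I x' u * ∑' x, Γ (b + w) x * H b' x x')|
      ≤ 3 * C_J * C_J' * (1 + 16 / δ ^ 2) *
        ((C_I * (C_H * Zl 4 δH)) *
          ((256 / 27 * C_Γ' * (Real.exp (δH / 2) * (2 / δH) * Zl 4 (δH / 2)))
              * ((1 + 2 * (R : ℝ) ^ 2) * (1 + 80 * Real.exp ((3 * δ / 4) / 2) * (2 / (3 * δ / 4)))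
                + 2 * (1 + 160 * Real.exp ((3 * δ / 4) / 2) * (2 / (3 * δ / 4)) ^ 3)) * n
            + (2 * C_Γ * 20 ^ 8 * (40320 * Real.exp (δH / 2) * (2 / δH) ^ 8 * Zl 4 (δH / 2))
                + (8 * C_Γ * (Real.exp (δH / 2) * (2 / δH) * Zl 4 (δH / 2)) + 2 * C_Γ * (Real.exp (δH / 2) * Zl 4 (δH / 2))) * 5 ^ 8)
              * 81 * (3 + 2 * (R : ℝ) ^ 2)) * A_M) := by
  have hCI : 0 ≤ C_I := (abs_nonneg _).trans (hI0 v₀ v₀)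
  have hCΓ : 0 ≤ C_Γ := (abs_nonneg _).trans (hΓ0 v₀ v₀)
  have hCΓ' : 0 ≤ C_Γ' := by
    have h := hΓ1 v₀ v₀ 0
    rw [sub_self, show supNorm (0 : Pt) = 0 from DyadicShell.supNorm_eq_zero_iff.mpr rfl] at h
    norm_num at h
    exact (abs_nonneg _).trans h
  have hCH : 0 ≤ C_H := by
    have h := hH v₀ v₀ v₀
    rw [sub_self, show l1 (0 : Pt) = 0 by unfold l1; simp, mul_zero, Real.exp_zero, mul_one, mul_one] at h
    exact (abs_nonneg _).trans h
  have hZ : 0 < Zl 4 δH := Zl_pos hδH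
  have hZ2 : 0 < Zl 4 (δH / 2) := Zl_pos (half_pos hδH)
  have hK₁ : 0 ≤ 256 / 27 * C_Γ' * (Real.exp (δH / 2) * (2 / δH) * Zl 4 (δH / 2)) := by positivity
  have hK₂ : 0 ≤ 2 * C_Γ * 20 ^ 8 * (40320 * Real.exp (δH / 2) * (2 / δH) ^ 8 * Zl 4 (δH / 2))
      + (8 * C_Γ * (Real.exp (δH / 2) * (2 / δH) * Zl 4 (δH / 2)) + 2 * C_Γ * (Real.exp (δH / 2) * Zl 4 (δH / 2))) * 5 ^ 8 := by
    positivity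
  have hL : 0 ≤ C_I * (C_H * Zl 4 δH) := by positivity
  exact coarse_secondMoment_of_majorant (J := J)
    (k := fun b b' => ∑ u ∈ U b, ∑ w ∈ W, qd u b (b + w) * ∑' x', I x' u * ∑' x, Γ (b + w) x * H b' x x')
    hδ hn S V v₀ (fun b b' => abs_mix3_le_mass (I := I) hδ hδH hn hI0 hΓ0 hΓ1 hH hH0 b b') hJ hJ'
    (windowedMajorant_mix3_le (qd := qd) (U := U) hδ hn hK₁ hK₂ hL hW S v₀ hM)

end Mix3

end Summit.QuantumFields.BalabanUV.Beta.FP.MixLoopPowerCountingMassCubic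

end
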